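import Mathlib.MeasureTheory.Measure.Lebesgue.EqHaar
import Mathlib.MeasureTheory.Measure.Haar.InnerProductSpace
import Mathlib.Analysis.InnerProductSpace.PiL2
import Mathlib.MeasureTheory.Integral.Bochner.Set
import Mathlib.Analysis.SpecialFunctions.Pow.Real
import HarnessLib

/-!
# The symmetric decreasing rearrangement onto `ℝⁿ` of a function on a measure space

Topic `Literature/Analysis/FunctionSpaces`. For a real function `u` on a measure space `(X, μ)` and
a dimension `n`, the **symmetric decreasing rearrangement** `u♯ = symmDecRearr n μ u : ℝⁿ → ℝ` is
the radial, radially non-increasing function whose superlevel sets `{u♯ > t}` (`t ≥ 0`) are the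
centred open balls `{u > t}^*` of volume `μ{u > t}` (Burchard 2009, *A short course on
rearrangement inequalities*, §1.1: `f^*(x) = ∫₀^∞ 𝟙_{{f>t}^*}(x) dt`, `{f^* > t} = {f > t}^*`,
equimeasurability (1.2); here with an arbitrary measure space as the source, which for a metric
measure space and `n = N` is the non-increasing rearrangement `û` of Balogh–Kristály–Tripaldi 2024,
(2.3), read radially: `u♯(x) = û(‖x‖)`). We DEFINE it by the equivalent formula
`u♯(x) = sup {t > 0 : |B(0,‖x‖)| < μ{u > t}}` and PROVE:

* `symmDecRearr_nonneg`, `symmDecRearr_le`, `symmDecRearr_eq_of_norm_eq`, `symmDecRearr_antitone`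
  — `0 ≤ u♯ ≤ M` for an a.e. bound `M` of `u`, `u♯` is radial and radially non-increasing;
* `lt_symmDecRearr_iff` — **`{u♯ > t} = {u > t}^*`**: `u♯(x) > t ≥ 0 ↔ |B(0,‖x‖)| < μ{u > t}`
  (continuity of `μ` from below);
* `exists_setOf_volume_ball_lt_eq_ball` — `{x : |B(0,‖x‖)| < c}` is a centred ball of volume `c`;
* `volume_lt_symmDecRearr` — **equimeasurability** `|{u♯ > t}| = μ{u > t}` (`t ≥ 0`);
* `measurable_symmDecRearr`, `hasCompactSupport_symmDecRearr` (when `μ{u > 0} < ∞`);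
* `map_restrict_symmDecRearr_eq` — the push-forwards of `μ|{u>0}` by `u` and of `dx|{u♯>0}` by `u♯`
  coincide; hence `integral_comp_symmDecRearr`: **`∫ F(u♯) dx = ∫ F(u) dμ`** for every measurable
  `F` with `F(0) = 0` and `u ≥ 0` (Burchard 2009, Lemma 1.4 for `F = |·|ᵖ`), in particular
  `integral_symmDecRearr_sq` (`L²` norm) and `integral_symmDecRearr_sq_mul_log` (entropy
  `∫ u² log u²`, the two displays of Balogh–Kristály–Tripaldi 2024, §3.1);
* `continuous_volume_ball_norm`, `isOpen_setOf_lt_symmDecRearr` — `{u♯ > t}` is open (`u♯` is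
  lower semicontinuous, Burchard 2009, §1.1);
* `volume_le_symmDecRearr` — equimeasurability of the CLOSED superlevel sets, `|{u♯ ≥ t}| = μ{u ≥ t}`
  (`t > 0`), by continuity of the measures from above;
* `isClosed_setOf_le_symmDecRearr`, `continuous_symmDecRearr` — **if the distribution function
  `t ↦ μ{u > t}` is strictly decreasing on `[0, M]` (`M` an a.e. bound of `u`), then `u♯` is
  continuous** (no plateau of the distribution function means no jump of the generalised inverse:
  `{u♯ ≥ t} = {x : |B(0,‖x‖)| ≤ inf_{s<t} μ{u > s}}` is closed, so `u♯` is also upper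
  semicontinuous) — the situation of a continuous `u` on a connected space charging open sets.

Everything is proved; one definition (`symmDecRearr`), no named facts. What is NOT here: any
regularity of `u♯` beyond measurability (Lipschitz / Sobolev regularity and the Pólya–Szegő
inequality need the isoperimetric inequality and the coarea formula), the Hardy–Littlewood and Riesz
rearrangement inequalities.

## References

* [Burchard2009] A. Burchard, *A Short Course on Rearrangement Inequalities*, lecture notes (2009),
  §1.1 (definition, (1.1)–(1.2), Ex. 1.1), §1.2 (layer cake, Lemma 1.4). READ (held text).
* [BaloghKristalyTripaldi2024] Z. M. Balogh, A. Kristály, F. Tripaldi, J. Funct. Anal. 286 (2024)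
  110217, §2.1 (2.3) and §3.1.
* [LiebLoss2001] E. H. Lieb, M. Loss, *Analysis*, 2nd ed., AMS 2001, §3.3 (same construction).
-/

noncomputable section

open MeasureTheory Set Filter Topology Metric
open scoped ENNReal NNReal

namespace Literature.Analysis.FunctionSpaces

variable {X : Type*} [MeasurableSpace X]

/-- **The symmetric decreasing rearrangement** of a real function `u` on a measure space `(X, μ)`
onto Euclidean `ℝⁿ`: `u♯(x) = sup {t > 0 : |B(0, ‖x‖)| < μ{u > t}}` (and `0` if there is no such
`t`), i.e. `u♯(x) > t ≥ 0` iff `x` lies in the centred open ball `{u > t}^*` of volume `μ{u > t}`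
(`lt_symmDecRearr_iff`). For `X = ℝⁿ` with Lebesgue measure this is the classical symmetric
decreasing rearrangement `f^*(x) = ∫₀^∞ 𝟙_{{f>t}^*}(x) dt` of Burchard 2009, §1.1 (the set
`{t > 0 : x ∈ {f>t}^*}` is an initial segment of `(0, ∞)`, so its length is its supremum); for a
metric measure space `(X, d, m)` and `n = N` it is the non-increasing rearrangement `û` onto the
model space `([0,∞), N σ_N r^{N-1} dr)` of Balogh–Kristály–Tripaldi 2024, (2.3), read radially,
`u♯(x) = û(‖x‖)`. [cite: Burchard2009, §1.1 (definition of `f^*`, (1.1)–(1.2))] -/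
def symmDecRearr (n : ℕ) (μ : Measure X) (u : X → ℝ) (x : EuclideanSpace ℝ (Fin n)) : ℝ :=
  sSup {t : ℝ | 0 < t ∧ volume (ball (0 : EuclideanSpace ℝ (Fin n)) ‖x‖) < μ {a | t < u a}}

variable {n : ℕ} {μ : Measure X} {u : X → ℝ}

/-- Unfolding lemma for `symmDecRearr`. [cite: Burchard2009, §1.1] -/
theorem symmDecRearr_def (x : EuclideanSpace ℝ (Fin n)) :
    symmDecRearr n μ u x =
      sSup {t : ℝ | 0 < t ∧ volume (ball (0 : EuclideanSpace ℝ (Fin n)) ‖x‖) < μ {a | t < u a}} :=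
  rfl

/-- `u♯ ≥ 0`. [cite: Burchard2009, §1.1] -/
theorem symmDecRearr_nonneg (x : EuclideanSpace ℝ (Fin n)) : 0 ≤ symmDecRearr n μ u x :=
  Real.sSup_nonneg fun _ ht ↦ ht.1.le

/-- Every admissible level `t` (with `|B(0,‖x‖)| < μ{u > t}`) lies below an a.e. upper bound `M`
of `u`. [folklore] -/
theorem lt_of_mem_symmDecRearr_set {M : ℝ} (hM : μ {a | M < u a} = 0)
    {x : EuclideanSpace ℝ (Fin n)} {t : ℝ}
    (ht : t ∈ {t : ℝ | 0 < t ∧ volume (ball (0 : EuclideanSpace ℝ (Fin n)) ‖x‖) < μ {a | t < u a}}) :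
    t < M := by
  by_contra h
  rw [not_lt] at h
  have h0 : μ {a | t < u a} = 0 :=
    measure_mono_null (fun a (ha : t < u a) ↦ lt_of_le_of_lt h ha) hM
  have h2 := ht.2
  rw [h0] at h2
  exact ENNReal.not_lt_zero h2

/-- The defining set of `u♯(x)` is bounded above (by any a.e. upper bound of `u`). [folklore] -/
theorem bddAbove_symmDecRearr_set {M : ℝ} (hM : μ {a | M < u a} = 0)
    (x : EuclideanSpace ℝ (Fin n)) :
    BddAbove {t : ℝ | 0 < t ∧ volume (ball (0 : EuclideanSpace ℝ (Fin n)) ‖x‖) < μ {a | t < u a}} :=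
  ⟨M, fun _ ht ↦ (lt_of_mem_symmDecRearr_set hM ht).le⟩

/-- `u♯ ≤ M` for any a.e. upper bound `M ≥ 0` of `u`. [cite: Burchard2009, §1.1] -/
theorem symmDecRearr_le {M : ℝ} (hM : μ {a | M < u a} = 0) (hM0 : 0 ≤ M)
    (x : EuclideanSpace ℝ (Fin n)) : symmDecRearr n μ u x ≤ M :=
  Real.sSup_le (fun _ ht ↦ (lt_of_mem_symmDecRearr_set hM ht).le) hM0

/-- `u♯` is radial. [cite: Burchard2009, §1.1] -/
theorem symmDecRearr_eq_of_norm_eq {x y : EuclideanSpace ℝ (Fin n)} (h : ‖x‖ = ‖y‖) :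
    symmDecRearr n μ u x = symmDecRearr n μ u y := by
  simp only [symmDecRearr_def, h]

/-- `u♯` is radially non-increasing. [cite: Burchard2009, §1.1] -/
theorem symmDecRearr_antitone {M : ℝ} (hM : μ {a | M < u a} = 0)
    {x y : EuclideanSpace ℝ (Fin n)} (h : ‖x‖ ≤ ‖y‖) :
    symmDecRearr n μ u y ≤ symmDecRearr n μ u x := by
  rw [symmDecRearr_def, symmDecRearr_def]
  by_cases hne : {t : ℝ | 0 < t ∧
      volume (ball (0 : EuclideanSpace ℝ (Fin n)) ‖y‖) < μ {a | t < u a}}.Nonempty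
  · exact csSup_le_csSup (bddAbove_symmDecRearr_set hM x) hne fun t ht ↦
      ⟨ht.1, lt_of_le_of_lt (measure_mono (ball_subset_ball h)) ht.2⟩
  · rw [not_nonempty_iff_eq_empty.1 hne, Real.sSup_empty]
    exact Real.sSup_nonneg fun _ ht ↦ ht.1.le

/-- **Superlevel sets of the rearrangement**: for `t ≥ 0`, `u♯(x) > t` iff `|B(0,‖x‖)| < μ{u > t}`
(i.e. `{u♯ > t} = {u > t}^*`, Burchard 2009, Exercise 1.1); `←` is continuity of the measure from
below along `{u > t + 1/(k+1)} ↑ {u > t}`. [cite: Burchard2009, §1.1, (1.2) and Ex. 1.1] -/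
theorem lt_symmDecRearr_iff {M : ℝ} (hM : μ {a | M < u a} = 0) {x : EuclideanSpace ℝ (Fin n)}
    {t : ℝ} (ht : 0 ≤ t) :
    t < symmDecRearr n μ u x ↔
      volume (ball (0 : EuclideanSpace ℝ (Fin n)) ‖x‖) < μ {a | t < u a} := by
  have hbdd := bddAbove_symmDecRearr_set hM x
  rw [symmDecRearr_def]
  constructor
  · intro h
    have hne : {s : ℝ | 0 < s ∧
        volume (ball (0 : EuclideanSpace ℝ (Fin n)) ‖x‖) < μ {a | s < u a}}.Nonempty := by
      by_contra hemp
      rw [not_nonempty_iff_eq_empty] at hemp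
      rw [hemp, Real.sSup_empty] at h
      exact absurd h (not_lt.2 ht)
    obtain ⟨s, hs, hts⟩ := exists_lt_of_lt_csSup hne h
    exact lt_of_lt_of_le hs.2 (measure_mono fun a (ha : s < u a) ↦ lt_trans hts ha)
  · intro h
    have hU : {a | t < u a} = ⋃ k : ℕ, {a | t + 1 / ((k : ℝ) + 1) < u a} := by
      ext a
      simp only [mem_setOf_eq, mem_iUnion]
      constructor
      · intro hta
        obtain ⟨k, hk⟩ := exists_nat_one_div_lt (sub_pos.2 hta)
        exact ⟨k, by linarith⟩
      · rintro ⟨k, hk⟩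
        have : 0 < 1 / ((k : ℝ) + 1) := by positivity
        linarith
    have hmono : Monotone fun k : ℕ ↦ {a | t + 1 / ((k : ℝ) + 1) < u a} := by
      intro k l hkl a ha
      have hle : 1 / ((l : ℝ) + 1) ≤ 1 / ((k : ℝ) + 1) :=
        one_div_le_one_div_of_le (by positivity) (by exact_mod_cast Nat.add_le_add_right hkl 1)
      have ha' : t + 1 / ((k : ℝ) + 1) < u a := ha
      change t + 1 / ((l : ℝ) + 1) < u a
      linarith
    have htend := tendsto_measure_iUnion_atTop (μ := μ) hmono
    rw [← hU] at htend
    obtain ⟨k, hk⟩ := ((tendsto_order.1 htend).1 _ h).exists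
    have hmem : t + 1 / ((k : ℝ) + 1) ∈ {s : ℝ | 0 < s ∧
        volume (ball (0 : EuclideanSpace ℝ (Fin n)) ‖x‖) < μ {a | s < u a}} :=
      ⟨by positivity, hk⟩
    have hlt : t < t + 1 / ((k : ℝ) + 1) := by
      have : 0 < 1 / ((k : ℝ) + 1) := by positivity
      linarith
    exact lt_of_lt_of_le hlt (le_csSup hbdd hmem)

/-! ### Balls of prescribed volume -/

/-- **The set `{x : |B(0,‖x‖)| < c}` is a centred ball of volume `c`** (`n ≥ 1`, `c < ∞`): it is
`B(0, ρ)` with `ω_n ρⁿ = c`. [folklore] -/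
theorem exists_setOf_volume_ball_lt_eq_ball (hn : n ≠ 0) {c : ℝ≥0∞} (hc : c ≠ ∞) :
    ∃ ρ : ℝ, 0 ≤ ρ ∧
      {x : EuclideanSpace ℝ (Fin n) | volume (ball (0 : EuclideanSpace ℝ (Fin n)) ‖x‖) < c} = ball 0 ρ ∧
      volume (ball (0 : EuclideanSpace ℝ (Fin n)) ρ) = c := by
  haveI : Nontrivial (EuclideanSpace ℝ (Fin n)) :=
    Module.nontrivial_of_finrank_pos (R := ℝ) (by rw [finrank_euclideanSpace_fin]; omega)
  set σ : ℝ≥0∞ := volume (ball (0 : EuclideanSpace ℝ (Fin n)) 1) with hσ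
  have hσ0 : σ ≠ 0 := (measure_ball_pos volume (0 : EuclideanSpace ℝ (Fin n)) one_pos).ne'
  have hσT : σ ≠ ∞ := measure_ball_lt_top.ne
  have hσr : 0 < σ.toReal := ENNReal.toReal_pos hσ0 hσT
  have hball : ∀ r : ℝ, 0 ≤ r →
      volume (ball (0 : EuclideanSpace ℝ (Fin n)) r) = ENNReal.ofReal (r ^ n * σ.toReal) := by
    intro r hr
    rw [Measure.addHaar_ball volume 0 hr, finrank_euclideanSpace_fin, ← hσ,
      ENNReal.ofReal_mul (pow_nonneg hr n), ENNReal.ofReal_toReal hσT]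
  have hcs : 0 ≤ c.toReal / σ.toReal := div_nonneg ENNReal.toReal_nonneg hσr.le
  set ρ : ℝ := (c.toReal / σ.toReal) ^ (1 / (n : ℝ)) with hρ
  have hρ0 : 0 ≤ ρ := Real.rpow_nonneg hcs _
  have hρn : ρ ^ n = c.toReal / σ.toReal := by
    rw [hρ, ← Real.rpow_natCast, ← Real.rpow_mul hcs, one_div_mul_cancel (Nat.cast_ne_zero.2 hn),
      Real.rpow_one]
  refine ⟨ρ, hρ0, ?_, ?_⟩
  · ext x
    rw [mem_setOf_eq, mem_ball_zero_iff, hball _ (norm_nonneg x), ← ENNReal.ofReal_toReal hc,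
      ENNReal.ofReal_lt_ofReal_iff_of_nonneg (mul_nonneg (pow_nonneg (norm_nonneg x) n) hσr.le),
      ← lt_div_iff₀ hσr, ← hρn, pow_lt_pow_iff_left₀ (norm_nonneg x) hρ0 hn]
  · rw [hball ρ hρ0, hρn, div_mul_cancel₀ _ hσr.ne', ENNReal.ofReal_toReal hc]

/-- The volume function `x ↦ |B(0,‖x‖)|` is measurable (monotone in `‖x‖`). [folklore] -/
theorem measurable_volume_ball_norm :
    Measurable fun x : EuclideanSpace ℝ (Fin n) ↦
      volume (ball (0 : EuclideanSpace ℝ (Fin n)) ‖x‖) := by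
  have hmono : Monotone fun r : ℝ ↦ volume (ball (0 : EuclideanSpace ℝ (Fin n)) r) :=
    fun r s hrs ↦ measure_mono (ball_subset_ball hrs)
  exact hmono.measurable.comp continuous_norm.measurable

/-! ### Equimeasurability, measurability, support -/

/-- **Equimeasurability** (`μ_f(t) = μ_{f^*}(t)`, Burchard 2009, (1.2)): for `t ≥ 0` with
`μ{u > t} < ∞`, `|{u♯ > t}| = μ{u > t}` (`n ≥ 1`, `u` a.e. bounded above).
[cite: Burchard2009, §1.1 (1.2)] -/
theorem volume_lt_symmDecRearr (hn : n ≠ 0) {M : ℝ} (hM : μ {a | M < u a} = 0) {t : ℝ} (ht : 0 ≤ t)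
    (hfin : μ {a | t < u a} ≠ ∞) :
    volume {x : EuclideanSpace ℝ (Fin n) | t < symmDecRearr n μ u x} = μ {a | t < u a} := by
  have hset : {x : EuclideanSpace ℝ (Fin n) | t < symmDecRearr n μ u x} =
      {x | volume (ball (0 : EuclideanSpace ℝ (Fin n)) ‖x‖) < μ {a | t < u a}} := by
    ext x
    exact lt_symmDecRearr_iff hM ht
  obtain ⟨ρ, -, hball, hvol⟩ := exists_setOf_volume_ball_lt_eq_ball hn hfin
  rw [hset, hball, hvol]

/-- `u♯` is (Borel) measurable: its superlevel sets are centred balls, all of `ℝⁿ`, or sublevel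
sets of the measurable volume function. [cite: Burchard2009, §1.1 ("`f^*` is lower semicontinuous")] -/
theorem measurable_symmDecRearr {M : ℝ} (hM : μ {a | M < u a} = 0) :
    Measurable (symmDecRearr n μ u) := by
  refine measurable_of_Ioi fun t ↦ ?_
  by_cases ht : 0 ≤ t
  · have hset : symmDecRearr n μ u ⁻¹' Ioi t =
        {x | volume (ball (0 : EuclideanSpace ℝ (Fin n)) ‖x‖) < μ {a | t < u a}} := by
      ext x
      exact lt_symmDecRearr_iff hM ht
    rw [hset]
    exact measurableSet_lt measurable_volume_ball_norm measurable_const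
  · have hset : symmDecRearr n μ u ⁻¹' Ioi t = univ := by
      refine eq_univ_of_forall fun x ↦ ?_
      exact lt_of_lt_of_le (not_le.1 ht) (symmDecRearr_nonneg x)
    rw [hset]
    exact MeasurableSet.univ

/-- If `μ{u > 0} < ∞` then `u♯` has compact support (its positivity set is a centred ball of
volume `μ{u > 0}`). [cite: Burchard2009, §1.1] -/
theorem hasCompactSupport_symmDecRearr (hn : n ≠ 0) {M : ℝ} (hM : μ {a | M < u a} = 0)
    (hfin : μ {a | 0 < u a} ≠ ∞) : HasCompactSupport (symmDecRearr n μ u) := by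
  obtain ⟨ρ, -, hball, -⟩ := exists_setOf_volume_ball_lt_eq_ball hn hfin
  refine HasCompactSupport.intro (isCompact_closedBall (0 : EuclideanSpace ℝ (Fin n)) ρ)
    fun x hx ↦ ?_
  have hx' : x ∉ {x | volume (ball (0 : EuclideanSpace ℝ (Fin n)) ‖x‖) < μ {a | 0 < u a}} := by
    rw [hball]
    exact fun h ↦ hx (ball_subset_closedBall h)
  have hnot : ¬ 0 < symmDecRearr n μ u x := fun h ↦ hx' ((lt_symmDecRearr_iff hM le_rfl).1 h)
  exact le_antisymm (not_lt.1 hnot) (symmDecRearr_nonneg x)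

/-! ### Integrals of functions of `u` are preserved -/

/-- **The rearrangement preserves the distribution of positive values**: the push-forward of
`μ|{u>0}` under `u` equals the push-forward of Lebesgue measure`|{u♯>0}` under `u♯`, as (finite)
measures on `ℝ` (they agree on every `(t, ∞)` by equimeasurability). [cite: Burchard2009, §1.1 (1.2), §1.2] -/
theorem map_restrict_symmDecRearr_eq (hn : n ≠ 0) (hu : Measurable u) {M : ℝ}
    (hM : μ {a | M < u a} = 0) (hfin : μ {a | 0 < u a} ≠ ∞) :
    Measure.map (symmDecRearr n μ u)
        (volume.restrict {x : EuclideanSpace ℝ (Fin n) | 0 < symmDecRearr n μ u x}) =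
      Measure.map u (μ.restrict {a | 0 < u a}) := by
  set v := symmDecRearr n μ u with hv_def
  have hv : Measurable v := measurable_symmDecRearr hM
  have hfin' : ∀ {t : ℝ}, 0 ≤ t → μ {a | t < u a} ≠ ∞ := fun ht ↦
    ne_top_of_le_ne_top hfin (measure_mono fun a (ha : _ < u a) ↦ lt_of_le_of_lt ht ha)
  have hIoi : ∀ s : ℝ, (Measure.map v (volume.restrict {x | 0 < v x})) (Ioi s) =
      (Measure.map u (μ.restrict {a | 0 < u a})) (Ioi s) := by
    intro s
    rw [Measure.map_apply hv measurableSet_Ioi, Measure.map_apply hu measurableSet_Ioi,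
      Measure.restrict_apply (hv measurableSet_Ioi), Measure.restrict_apply (hu measurableSet_Ioi)]
    have h1 : v ⁻¹' Ioi s ∩ {x | 0 < v x} = {x | max s 0 < v x} := by
      ext x; simp
    have h2 : u ⁻¹' Ioi s ∩ {a | 0 < u a} = {a | max s 0 < u a} := by
      ext a; simp
    rw [h1, h2]
    exact volume_lt_symmDecRearr hn hM (le_max_right s 0) (hfin' (le_max_right s 0))
  have huniv : (Measure.map v (volume.restrict {x | 0 < v x})) univ =
      (Measure.map u (μ.restrict {a | 0 < u a})) univ := by
    rw [Measure.map_apply hv MeasurableSet.univ, Measure.map_apply hu MeasurableSet.univ,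
      preimage_univ, preimage_univ, Measure.restrict_apply_univ, Measure.restrict_apply_univ]
    exact volume_lt_symmDecRearr hn hM le_rfl hfin
  haveI : IsFiniteMeasure (Measure.map u (μ.restrict {a | 0 < u a})) := ⟨by
    rw [Measure.map_apply hu MeasurableSet.univ, preimage_univ, Measure.restrict_apply_univ]
    exact hfin.lt_top⟩
  haveI : IsFiniteMeasure (Measure.map v (volume.restrict {x | 0 < v x})) := ⟨by
    rw [huniv]; exact measure_lt_top _ _⟩
  refine Measure.ext_of_Iic _ _ fun a ↦ ?_
  rw [← compl_Ioi, measure_compl measurableSet_Ioi (measure_ne_top _ _),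
    measure_compl measurableSet_Ioi (measure_ne_top _ _), hIoi, huniv]

/-- **Integrals of functions of `u` are invariant under rearrangement**: for `u ≥ 0` measurable,
a.e. bounded above, with `μ{u > 0} < ∞`, and any measurable `F : ℝ → ℝ` with `F(0) = 0`,
`∫ F(u♯) dx = ∫ F(u) dμ` (no integrability needed: both sides vanish off the positivity sets, on
which the push-forward measures agree). The cases `F(s) = s^p` (Burchard 2009, Lemma 1.4:
`‖f‖_p = ‖f^*‖_p`) and `F(s) = s² log s²` (Balogh–Kristály–Tripaldi 2024, §3.1: "the operation of
rearrangement leaves both the `Lᵖ`-norm and entropy invariant") are `integral_symmDecRearr_sq`,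
`integral_symmDecRearr_sq_mul_log`. [cite: Burchard2009, §1.2 Lemma 1.4] -/
theorem integral_comp_symmDecRearr (hn : n ≠ 0) (hu : Measurable u) (hu0 : ∀ a, 0 ≤ u a) {M : ℝ}
    (hM : μ {a | M < u a} = 0) (hfin : μ {a | 0 < u a} ≠ ∞) {F : ℝ → ℝ} (hF : Measurable F)
    (hF0 : F 0 = 0) :
    ∫ x, F (symmDecRearr n μ u x) = ∫ a, F (u a) ∂μ := by
  set v := symmDecRearr n μ u with hv_def
  have hv : Measurable v := measurable_symmDecRearr hM
  have e1 : ∫ a, F (u a) ∂μ = ∫ a in {a | 0 < u a}, F (u a) ∂μ := by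
    refine (setIntegral_eq_integral_of_forall_compl_eq_zero fun a ha ↦ ?_).symm
    have : u a = 0 := le_antisymm (not_lt.1 ha) (hu0 a)
    rw [this, hF0]
  have e2 : ∫ x, F (v x) = ∫ x in {x | 0 < v x}, F (v x) := by
    refine (setIntegral_eq_integral_of_forall_compl_eq_zero fun x hx ↦ ?_).symm
    have : v x = 0 := le_antisymm (not_lt.1 hx) (symmDecRearr_nonneg x)
    rw [this, hF0]
  rw [e1, e2, ← integral_map hu.aemeasurable hF.aestronglyMeasurable,
    ← integral_map hv.aemeasurable hF.aestronglyMeasurable, hv_def,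
    map_restrict_symmDecRearr_eq hn hu hM hfin]

/-- `∫ (u♯)² dx = ∫ u² dμ`. [cite: Burchard2009, §1.2 Lemma 1.4] -/
theorem integral_symmDecRearr_sq (hn : n ≠ 0) (hu : Measurable u) (hu0 : ∀ a, 0 ≤ u a) {M : ℝ}
    (hM : μ {a | M < u a} = 0) (hfin : μ {a | 0 < u a} ≠ ∞) :
    ∫ x, (symmDecRearr n μ u x) ^ 2 = ∫ a, (u a) ^ 2 ∂μ :=
  integral_comp_symmDecRearr hn hu hu0 hM hfin (F := fun s ↦ s ^ 2) (measurable_id.pow_const 2)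
    (by simp)

/-- `∫ (u♯)² log (u♯)² dx = ∫ u² log u² dμ` (the entropy is invariant under rearrangement).
[cite: BaloghKristalyTripaldi2024, §3.1 (second display)] -/
theorem integral_symmDecRearr_sq_mul_log (hn : n ≠ 0) (hu : Measurable u) (hu0 : ∀ a, 0 ≤ u a)
    {M : ℝ} (hM : μ {a | M < u a} = 0) (hfin : μ {a | 0 < u a} ≠ ∞) :
    ∫ x, (symmDecRearr n μ u x) ^ 2 * Real.log ((symmDecRearr n μ u x) ^ 2) =
      ∫ a, (u a) ^ 2 * Real.log ((u a) ^ 2) ∂μ :=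
  integral_comp_symmDecRearr hn hu hu0 hM hfin (F := fun s ↦ s ^ 2 * Real.log (s ^ 2))
    ((measurable_id.pow_const 2).mul (Real.measurable_log.comp (measurable_id.pow_const 2)))
    (by simp)

/-! ### Semicontinuity, closed superlevel sets, continuity -/

/-- The volume function `x ↦ |B(0,‖x‖)| = ‖x‖ⁿ |B(0,1)|` is continuous (as an `ℝ≥0∞`-valued
function). [folklore] -/
theorem continuous_volume_ball_norm (hn : n ≠ 0) :
    Continuous fun x : EuclideanSpace ℝ (Fin n) ↦
      volume (ball (0 : EuclideanSpace ℝ (Fin n)) ‖x‖) := by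
  haveI : Nontrivial (EuclideanSpace ℝ (Fin n)) :=
    Module.nontrivial_of_finrank_pos (R := ℝ) (by rw [finrank_euclideanSpace_fin]; omega)
  have h : (fun x : EuclideanSpace ℝ (Fin n) ↦ volume (ball (0 : EuclideanSpace ℝ (Fin n)) ‖x‖)) =
      fun x ↦ ENNReal.ofReal (‖x‖ ^ n) * volume (ball (0 : EuclideanSpace ℝ (Fin n)) 1) := by
    funext x
    rw [Measure.addHaar_ball volume 0 (norm_nonneg x), finrank_euclideanSpace_fin]
  rw [h]
  exact (ENNReal.continuous_mul_const measure_ball_lt_top.ne).comp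
    (ENNReal.continuous_ofReal.comp (continuous_norm.pow n))

/-- **The superlevel sets `{u♯ > t}` are open** (`u♯` is lower semicontinuous; for `t ≥ 0` the
set is `{x : |B(0,‖x‖)| < μ{u > t}}`, for `t < 0` it is everything). [cite: Burchard2009, §1.1 ("`f^*` is lower semicontinuous")] -/
theorem isOpen_setOf_lt_symmDecRearr (hn : n ≠ 0) {M : ℝ} (hM : μ {a | M < u a} = 0) (t : ℝ) :
    IsOpen {x : EuclideanSpace ℝ (Fin n) | t < symmDecRearr n μ u x} := by
  by_cases ht : 0 ≤ t
  · have hset : {x : EuclideanSpace ℝ (Fin n) | t < symmDecRearr n μ u x} =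
        {x | volume (ball (0 : EuclideanSpace ℝ (Fin n)) ‖x‖) < μ {a | t < u a}} := by
      ext x
      exact lt_symmDecRearr_iff hM ht
    rw [hset]
    exact isOpen_lt (continuous_volume_ball_norm hn) continuous_const
  · have hset : {x : EuclideanSpace ℝ (Fin n) | t < symmDecRearr n μ u x} = univ :=
      eq_univ_of_forall fun x ↦ lt_of_lt_of_le (not_le.1 ht) (symmDecRearr_nonneg x)
    rw [hset]
    exact isOpen_univ

/-- **Equimeasurability of the closed superlevel sets**: for `t > 0` (and `μ{u > 0} < ∞`),
`|{u♯ ≥ t}| = μ{u ≥ t}` — both sides are limits of `|{u♯ > s_k}| = μ{u > s_k}` along `s_k ↑ t`.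
[cite: Burchard2009, §1.1 (1.2)] -/
theorem volume_le_symmDecRearr (hn : n ≠ 0) (hu : Measurable u) {M : ℝ} (hM : μ {a | M < u a} = 0)
    (hfin : μ {a | 0 < u a} ≠ ∞) {t : ℝ} (ht : 0 < t) :
    volume {x : EuclideanSpace ℝ (Fin n) | t ≤ symmDecRearr n μ u x} = μ {a | t ≤ u a} := by
  set v := symmDecRearr n μ u with hv
  -- the levels `s_k = t - t/(k+2) ∈ [0, t)`, increasing to `t`
  set s : ℕ → ℝ := fun k ↦ t - t / ((k : ℝ) + 2) with hs
  have hs0 : ∀ k, 0 ≤ s k := fun k ↦ by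
    have : t / ((k : ℝ) + 2) ≤ t := div_le_self ht.le (by linarith [(k.cast_nonneg : (0:ℝ) ≤ k)])
    simp only [hs]; linarith
  have hst : ∀ k, s k < t := fun k ↦ by
    have : 0 < t / ((k : ℝ) + 2) := by positivity
    simp only [hs]; linarith
  have hsmono : Monotone s := fun k l hkl ↦ by
    simp only [hs]
    have : t / ((l : ℝ) + 2) ≤ t / ((k : ℝ) + 2) :=
      div_le_div_of_nonneg_left ht.le (by positivity) (by simpa using (Nat.cast_le.2 hkl : (k:ℝ) ≤ l))
    linarith
  have hslim : Tendsto s atTop (𝓝 t) := by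
    have h1 : Tendsto (fun k : ℕ ↦ t / ((k : ℝ) + 2)) atTop (𝓝 0) := by
      have := (tendsto_one_div_add_atTop_nhds_zero_nat (𝕜 := ℝ)).comp (tendsto_add_atTop_nat 1)
      have e : (fun k : ℕ ↦ t / ((k : ℝ) + 2)) = fun k ↦ t * ((fun n : ℕ ↦ 1 / ((n : ℝ) + 1)) ∘
          (fun n ↦ n + 1)) k := by
        funext k
        simp only [Function.comp_apply, Nat.cast_add, Nat.cast_one]
        ring
      rw [e]
      simpa using this.const_mul t
    have := h1.const_sub t
    simpa [hs] using this
  -- the key property of the levels: `⋂_k {s_k < f} = {t ≤ f}`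
  have hkey : ∀ r : ℝ, (∀ k, s k < r) ↔ t ≤ r := by
    intro r
    constructor
    · intro h
      exact le_of_tendsto' hslim fun k ↦ (h k).le
    · intro h k
      exact (hst k).trans_le h
  have hA : {x : EuclideanSpace ℝ (Fin n) | t ≤ v x} = ⋂ k, {x | s k < v x} := by
    ext x; simp only [mem_setOf_eq, mem_iInter]; exact (hkey (v x)).symm
  have hB : {a | t ≤ u a} = ⋂ k, {a | s k < u a} := by
    ext a; simp only [mem_setOf_eq, mem_iInter]; exact (hkey (u a)).symm
  have hfin' : ∀ k, μ {a | s k < u a} ≠ ∞ := fun k ↦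
    ne_top_of_le_ne_top hfin (measure_mono fun a (ha : s k < u a) ↦ lt_of_le_of_lt (hs0 k) ha)
  have hmv : Measurable v := measurable_symmDecRearr hM
  -- continuity from above on both sides
  have h1 : Tendsto (fun k ↦ volume {x : EuclideanSpace ℝ (Fin n) | s k < v x}) atTop
      (𝓝 (volume {x : EuclideanSpace ℝ (Fin n) | t ≤ v x})) := by
    rw [hA]
    refine tendsto_measure_iInter_atTop (fun k ↦ (measurableSet_lt measurable_const hmv).nullMeasurableSet)
      (fun k l hkl x (hx : s l < v x) ↦ lt_of_le_of_lt (hsmono hkl) hx) ⟨0, ?_⟩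
    rw [volume_lt_symmDecRearr hn hM (hs0 0) (hfin' 0)]
    exact hfin' 0
  have h2 : Tendsto (fun k ↦ μ {a | s k < u a}) atTop (𝓝 (μ {a | t ≤ u a})) := by
    rw [hB]
    exact tendsto_measure_iInter_atTop (fun k ↦ (measurableSet_lt measurable_const hu).nullMeasurableSet)
      (fun k l hkl a (ha : s l < u a) ↦ lt_of_le_of_lt (hsmono hkl) ha) ⟨0, hfin' 0⟩
  have heq : (fun k ↦ volume {x : EuclideanSpace ℝ (Fin n) | s k < v x}) =
      fun k ↦ μ {a | s k < u a} := funext fun k ↦ volume_lt_symmDecRearr hn hM (hs0 k) (hfin' k)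
  rw [heq] at h1
  exact tendsto_nhds_unique h1 h2

/-- **No plateau of the distribution function ⇒ closed superlevel sets.** If `t ↦ μ{u > t}` is
strictly decreasing on `[0, M]` (`M` an a.e. bound of `u`), then for `t ≤ M` the set
`{u♯ ≥ t}` equals `{x : |B(0,‖x‖)| ≤ inf_{0 ≤ s < t} μ{u > s}}`, hence is closed. [folklore] -/
theorem isClosed_setOf_le_symmDecRearr (hn : n ≠ 0) {M : ℝ} (hM : μ {a | M < u a} = 0)
    (hstrict : StrictAntiOn (fun t ↦ μ {a | t < u a}) (Icc 0 M)) {t : ℝ} (htM : t ≤ M) :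
    IsClosed {x : EuclideanSpace ℝ (Fin n) | t ≤ symmDecRearr n μ u x} := by
  set L : ℝ≥0∞ := ⨅ s ∈ Ico 0 t, μ {a | s < u a} with hL
  have hset : {x : EuclideanSpace ℝ (Fin n) | t ≤ symmDecRearr n μ u x} =
      {x | volume (ball (0 : EuclideanSpace ℝ (Fin n)) ‖x‖) ≤ L} := by
    ext x
    simp only [mem_setOf_eq]
    constructor
    · intro hx
      refine le_iInf₂ fun s hs ↦ ?_
      exact ((lt_symmDecRearr_iff hM hs.1).1 (hs.2.trans_le hx)).le
    · intro hx
      -- every `s ∈ [0, t)` is an admissible level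
      have hadm : ∀ s ∈ Ico (0 : ℝ) t, s < symmDecRearr n μ u x := by
        intro s hs
        refine (lt_symmDecRearr_iff hM hs.1).2 ?_
        set s' := (s + t) / 2 with hs'
        have hs's : s < s' := by rw [hs']; linarith [hs.2]
        have hs't : s' < t := by rw [hs']; linarith [hs.2]
        have h1 : L ≤ μ {a | s' < u a} := iInf₂_le s' ⟨hs.1.trans hs's.le, hs't⟩
        have h2 : μ {a | s' < u a} < μ {a | s < u a} :=
          hstrict ⟨hs.1, (hs.2.le.trans htM)⟩ ⟨hs.1.trans hs's.le, hs't.le.trans htM⟩ hs's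
        exact lt_of_le_of_lt (hx.trans h1) h2
      by_contra hlt
      rw [not_le] at hlt
      have h0 : 0 ≤ symmDecRearr n μ u x := symmDecRearr_nonneg x
      exact lt_irrefl _ (hadm _ ⟨h0, hlt⟩)
  rw [hset]
  exact isClosed_le (continuous_volume_ball_norm hn) continuous_const

/-- **Continuity of the rearrangement.** If `u` is a.e. bounded by `M ≥ 0` and its distribution
function `t ↦ μ{u > t}` is strictly decreasing on `[0, M]` — e.g. `u = |f|` for a continuous
compactly supported `f` on a connected space whose measure charges open sets — then `u♯` is
continuous: it is lower semicontinuous (`isOpen_setOf_lt_symmDecRearr`) and upper semicontinuous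
(`isClosed_setOf_le_symmDecRearr`; `{u♯ ≥ t}` is empty for `t > M` and everything for `t ≤ 0`).
[cite: Burchard2009, §1.1] -/
theorem continuous_symmDecRearr (hn : n ≠ 0) {M : ℝ} (hM : μ {a | M < u a} = 0) (hM0 : 0 ≤ M)
    (hstrict : StrictAntiOn (fun t ↦ μ {a | t < u a}) (Icc 0 M)) :
    Continuous (symmDecRearr n μ u) := by
  rw [continuous_iff_lower_upperSemicontinuous]
  constructor
  · rw [lowerSemicontinuous_iff_isOpen_preimage]
    exact fun t ↦ isOpen_setOf_lt_symmDecRearr hn hM t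
  · rw [upperSemicontinuous_iff_isClosed_preimage]
    intro t
    change IsClosed {x | t ≤ symmDecRearr n μ u x}
    by_cases ht : t ≤ 0
    · have : {x : EuclideanSpace ℝ (Fin n) | t ≤ symmDecRearr n μ u x} = univ :=
        eq_univ_of_forall fun x ↦ ht.trans (symmDecRearr_nonneg x)
      rw [this]; exact isClosed_univ
    · by_cases htM : t ≤ M
      · exact isClosed_setOf_le_symmDecRearr hn hM hstrict htM
      · have : {x : EuclideanSpace ℝ (Fin n) | t ≤ symmDecRearr n μ u x} = ∅ :=
          eq_empty_of_forall_notMem fun x hx ↦ htM ((le_trans hx (symmDecRearr_le hM hM0 x)))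
        rw [this]; exact isClosed_empty

end Literature.Analysis.FunctionSpaces
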